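import Summits.ValiantsHypothesis.ValiantsHypothesis.Theorems.ValuativeGCTValuativeBoundNegativeEngine

/-!
# `ValuativeGCT.ValuativeBound` (stmt-ValiantsHypothesis-12625) — negative side, 2/5: load-bearing hypotheses

`truncation m L t n χ` is the crux's `T` verbatim with locus / threshold / degree / weight exposed
(`valuativeBound_iff : ValuativeBound ↔ … truncation m (rowLocus m U) (δ(m-r)) (mδ) λ*` by `Iff.rfl`).
Any proof of the crux must use
* the rank hypothesis `∀ u ∈ U, rank u ≤ r` — `valuativeBound_false_without_rank`
  (`withoutRank_fails_at m`, every `m ≥ 1`: `U = ⊤, r = 0, δ = 1, λ = (m)`, `I(everything)^m = 0`);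
* the guard `λ.parts.card ≤ m*m` — `valuativeBound_false_without_card` (`m = 1`, `λ = (1,1)`: the
  truncated weight `(-1)` has the wrong size; DEGREE–SIZE MISMATCH `eq_zero_of_degree_ne_size`);
and the threshold `δ(m-r)` cannot be raised by one — `valuativeBound_false_succ_threshold`.
Elementary; no new facts (the three `def … : Prop` are the refuted VARIANTS, each with its `¬`).
-/

noncomputable section

open MvPolynomial

namespace Summit.ValiantsHypothesis.Theorems.ValuativeBoundNegative

open Literature.NumberTheory.DiophantineGeometry Literature.Computability.AlgebraicComplexity

section Truncation

variable (m : ℕ)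

/-- `L_U` (ROWS, as in the crux): matrices all of whose rows lie in `U`. [folklore] -/
def rowLocus (U : Submodule ℂ (MatIdx m → ℂ)) : Set (MatIdx m × MatIdx m → ℂ) :=
  {p | ∀ j : MatIdx m, (fun i => p (j, i)) ∈ U}

/-- The COLUMN variant of `L_U` (NOT the crux's; used for a convention refutation). [folklore] -/
def colLocus (U : Submodule ℂ (MatIdx m → ℂ)) : Set (MatIdx m × MatIdx m → ℂ) :=
  {p | ∀ i : MatIdx m, (fun j => p (j, i)) ∈ U}

/-- Right-`Stab(det_m)`-invariants `G(A·M) = G(A)` — verbatim the crux's third conjunct. [folklore] -/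
def stabInvariants : Submodule ℂ (MvPolynomial (MatIdx m × MatIdx m) ℂ) :=
  ⨅ (M : Matrix (MatIdx m) (MatIdx m) ℂ) (_ : linSubst (MatIdx m) ℂ M (detFormLex ℂ m) = detFormLex ℂ m),
    LinearMap.ker ((MvPolynomial.aeval (R := ℂ) fun p : MatIdx m × MatIdx m =>
      ∑ l : MatIdx m, M l p.2 • MvPolynomial.X (p.1, l)).toLinearMap -
      LinearMap.id (R := ℂ) (M := MvPolynomial (MatIdx m × MatIdx m) ℂ))

/-- `B`-semi-invariants of weight `χ` for `G ↦ (A ↦ G(g⁻¹A))` — verbatim the crux's fourth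
conjunct. [folklore] -/
def borelSemiInvariants (χ : Weight (MatIdx m)) : Submodule ℂ (MvPolynomial (MatIdx m × MatIdx m) ℂ) :=
  ⨅ (g : Matrix.GeneralLinearGroup (MatIdx m) ℂ) (_ : IsUpperTriangular g),
    LinearMap.ker ((MvPolynomial.aeval (R := ℂ) fun p : MatIdx m × MatIdx m =>
      ∑ l : MatIdx m, ((g⁻¹ : Matrix.GeneralLinearGroup (MatIdx m) ℂ) :
        Matrix (MatIdx m) (MatIdx m) ℂ) p.1 l • MvPolynomial.X (l, p.2)).toLinearMap -
      weightChar χ g • LinearMap.id (R := ℂ) (M := MvPolynomial (MatIdx m × MatIdx m) ℂ))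

/-- The valuative truncation `T` with vanishing locus `L`, threshold `t`, degree `n`, weight `χ`:
`Hom_n ⊓ I(L)^t ⊓ Stab-invariants ⊓ B_χ-semi-invariants`. The crux's `T_U(λ)` is
`truncation m (rowLocus m U) (δ*(m-r)) (m*δ) λ*` (`valuativeBound_iff`). [folklore] -/
def truncation (L : Set (MatIdx m × MatIdx m → ℂ)) (t n : ℕ) (χ : Weight (MatIdx m)) :
    Submodule ℂ (MvPolynomial (MatIdx m × MatIdx m) ℂ) :=
  MvPolynomial.homogeneousSubmodule (MatIdx m × MatIdx m) ℂ n ⊓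
    ((MvPolynomial.vanishingIdeal ℂ L) ^ t).restrictScalars ℂ ⊓ stabInvariants m ⊓ borelSemiInvariants m χ

/-- **Definitional anchor.** The crux, restated through `truncation` — by `Iff.rfl`. Every variant
below changes exactly one argument of this normal form. [folklore] -/
theorem valuativeBound_iff :
    Summit.ValiantsHypothesis.ValiantsHypothesis.Theses.ValuativeGCT.ValuativeBound ↔
      ∀ (m : ℕ) [NeZero m] (U : Submodule ℂ (MatIdx m → ℂ)) (r : ℕ),
        (∀ u ∈ U, (Matrix.of fun a b : Fin m => u (toLex (a, b))).rank ≤ r) →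
        ∀ (δ : ℕ) (lam : Nat.Partition (m * δ)), lam.parts.card ≤ m * m →
          orbitMultiplicity ℂ (detFormLex ℂ m) m (Weight.dualOfPartition (m * m) lam).toMatIdx ≤
            Module.finrank ℂ (truncation m (rowLocus m U) (δ * (m - r)) (m * δ)
              (Weight.dualOfPartition (m * m) lam).toMatIdx) :=
  Iff.rfl

variable {m}

/-- Membership in the truncation, clause by clause. [folklore] -/
theorem mem_truncation_iff {L : Set (MatIdx m × MatIdx m → ℂ)} {t n : ℕ} {χ : Weight (MatIdx m)}
    {G : MvPolynomial (MatIdx m × MatIdx m) ℂ} :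
    G ∈ truncation m L t n χ ↔ G ∈ MvPolynomial.homogeneousSubmodule (MatIdx m × MatIdx m) ℂ n ∧
      G ∈ (MvPolynomial.vanishingIdeal ℂ L) ^ t ∧ G ∈ stabInvariants m ∧ G ∈ borelSemiInvariants m χ := by
  simp only [truncation, Submodule.mem_inf, Submodule.restrictScalars_mem, and_assoc]

/-- The Borel clause as a family of substitution identities. [folklore] -/
theorem mem_borelSemiInvariants_iff {χ : Weight (MatIdx m)} {G : MvPolynomial (MatIdx m × MatIdx m) ℂ} :
    G ∈ borelSemiInvariants m χ ↔ ∀ g : GL (MatIdx m) ℂ, IsUpperTriangular g →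
      MvPolynomial.aeval (fun p : MatIdx m × MatIdx m =>
        ∑ l : MatIdx m, ((g⁻¹ : GL (MatIdx m) ℂ) : Matrix (MatIdx m) (MatIdx m) ℂ) p.1 l • X (l, p.2)) G =
      weightChar χ g • G := by
  simp only [borelSemiInvariants, Submodule.mem_iInf, LinearMap.mem_ker, LinearMap.sub_apply,
    LinearMap.smul_apply, LinearMap.id_apply, AlgHom.toLinearMap_apply, sub_eq_zero]

/-- The Stab clause as a family of substitution identities. [folklore] -/
theorem mem_stabInvariants_iff {G : MvPolynomial (MatIdx m × MatIdx m) ℂ} :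
    G ∈ stabInvariants m ↔ ∀ M : Matrix (MatIdx m) (MatIdx m) ℂ,
      linSubst (MatIdx m) ℂ M (detFormLex ℂ m) = detFormLex ℂ m →
      MvPolynomial.aeval (fun p : MatIdx m × MatIdx m => ∑ l : MatIdx m, M l p.2 • X (p.1, l)) G = G := by
  simp only [stabInvariants, Submodule.mem_iInf, LinearMap.mem_ker, LinearMap.sub_apply,
    LinearMap.id_apply, AlgHom.toLinearMap_apply, sub_eq_zero]

/-- `L_⊤ = everything` (rows). [folklore] -/
theorem rowLocus_top : rowLocus m ⊤ = Set.univ := by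
  ext p; simp [rowLocus]

/-- Over `ℂ` the only polynomial vanishing everywhere is `0`. [folklore] -/
theorem vanishingIdeal_univ :
    MvPolynomial.vanishingIdeal ℂ (Set.univ : Set (MatIdx m × MatIdx m → ℂ)) = ⊥ := by
  refine le_antisymm (fun G hG => ?_) bot_le
  rw [MvPolynomial.mem_vanishingIdeal_iff] at hG
  rw [Ideal.mem_bot]
  apply MvPolynomial.funext
  intro x
  rw [map_zero, ← MvPolynomial.coe_aeval_eq_eval]
  exact hG x (Set.mem_univ x)

/-- **With a positive threshold and the total locus, the truncation is zero.** [folklore] -/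
theorem truncation_univ_eq_bot {t : ℕ} (ht : t ≠ 0) (n : ℕ) (χ : Weight (MatIdx m)) :
    truncation m (Set.univ : Set (MatIdx m × MatIdx m → ℂ)) t n χ = ⊥ := by
  rw [eq_bot_iff]
  intro G hG
  rw [mem_truncation_iff, vanishingIdeal_univ, ← Ideal.zero_eq_bot, zero_pow ht,
    Ideal.zero_eq_bot, Ideal.mem_bot] at hG
  exact (Submodule.mem_bot ℂ).mpr hG.2.1

end Truncation

/-- **Any proof must use the rank hypothesis**, at every `m ≥ 1`: with it deleted, the instance
`U = ⊤, r = 0, δ = 1, λ = (m)` reads `1 ≤ K_m((m)*) ≤ dim (Hom_m ∩ I(everything)^m ∩ …) = 0`. [folklore] -/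
theorem withoutRank_fails_at (m : ℕ) [NeZero m] :
    ¬ (∀ (U : Submodule ℂ (MatIdx m → ℂ)) (r : ℕ) (δ : ℕ) (lam : Nat.Partition (m * δ)),
      lam.parts.card ≤ m * m →
        orbitMultiplicity ℂ (detFormLex ℂ m) m (Weight.dualOfPartition (m * m) lam).toMatIdx ≤
          Module.finrank ℂ (truncation m (rowLocus m U) (δ * (m - r)) (m * δ)
            (Weight.dualOfPartition (m * m) lam).toMatIdx)) := by
  intro h
  have h1 := h ⊤ 0 1 (Nat.Partition.indiscrete (m * 1)) (card_parts_indiscrete_le m _)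
  rw [rowLocus_top, truncation_univ_eq_bot (by simpa using NeZero.ne m), finrank_bot] at h1
  exact Nat.not_succ_le_zero _ (le_trans (one_le_orbitMultiplicity_det_indiscrete m 1) h1)

/-- **The crux without the rank hypothesis is FALSE.** [folklore] -/
theorem valuativeBound_false_without_rank :
    ¬ (∀ (m : ℕ) [NeZero m] (U : Submodule ℂ (MatIdx m → ℂ)) (r : ℕ) (δ : ℕ) (lam : Nat.Partition (m * δ)),
        lam.parts.card ≤ m * m →
          orbitMultiplicity ℂ (detFormLex ℂ m) m (Weight.dualOfPartition (m * m) lam).toMatIdx ≤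
            Module.finrank ℂ (truncation m (rowLocus m U) (δ * (m - r)) (m * δ)
              (Weight.dualOfPartition (m * m) lam).toMatIdx)) :=
  fun h => withoutRank_fails_at 1 (h 1)

/-- **The threshold `δ(m-r)` cannot be raised by one**, at every `m ≥ 1`: witness `U = ⊤, r = m`
(every matrix has rank `≤ m`), `δ = 1`, `λ = (m)`: the crux's threshold is `0`, the raised one is
`1`, and `I(everything)^1 = 0` kills `T` while `K_m((m)*) ≥ 1`. (The honest tightness witness —
order of vanishing EXACTLY `δ(m-r)` along `L_U` for `U = 0` — is the `m = 1` computation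
`T_0 = ℂ·A^δ`, `A^δ ∉ (A)^(δ+1)`; gen-1 `not_valuativeBoundSharperThreshold`.) [folklore] -/
theorem succThreshold_fails_at (m : ℕ) [NeZero m] :
    ¬ (∀ (U : Submodule ℂ (MatIdx m → ℂ)) (r : ℕ),
      (∀ u ∈ U, (Matrix.of fun a b : Fin m => u (toLex (a, b))).rank ≤ r) →
      ∀ (δ : ℕ) (lam : Nat.Partition (m * δ)), lam.parts.card ≤ m * m →
        orbitMultiplicity ℂ (detFormLex ℂ m) m (Weight.dualOfPartition (m * m) lam).toMatIdx ≤
          Module.finrank ℂ (truncation m (rowLocus m U) (δ * (m - r) + 1) (m * δ)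
            (Weight.dualOfPartition (m * m) lam).toMatIdx)) := by
  intro h
  have h1 := h ⊤ m (fun u _ => Matrix.rank_le_width _) 1 (Nat.Partition.indiscrete (m * 1))
    (card_parts_indiscrete_le m _)
  rw [rowLocus_top, truncation_univ_eq_bot (by simp), finrank_bot] at h1
  exact Nat.not_succ_le_zero _ (le_trans (one_le_orbitMultiplicity_det_indiscrete m 1) h1)

/-- **The crux with threshold `δ(m-r)+1` is FALSE.** [folklore] -/
theorem valuativeBound_false_succ_threshold :
    ¬ (∀ (m : ℕ) [NeZero m] (U : Submodule ℂ (MatIdx m → ℂ)) (r : ℕ),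
        (∀ u ∈ U, (Matrix.of fun a b : Fin m => u (toLex (a, b))).rank ≤ r) →
        ∀ (δ : ℕ) (lam : Nat.Partition (m * δ)), lam.parts.card ≤ m * m →
          orbitMultiplicity ℂ (detFormLex ℂ m) m (Weight.dualOfPartition (m * m) lam).toMatIdx ≤
            Module.finrank ℂ (truncation m (rowLocus m U) (δ * (m - r) + 1) (m * δ)
              (Weight.dualOfPartition (m * m) lam).toMatIdx)) :=
  fun h => succThreshold_fails_at 1 (h 1)

section Scalar

variable {m : ℕ}

/-- The inverse of the torus element `diag(x)` is `diag(x⁻¹)`. [folklore] -/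
theorem coe_inv_torusElt {σ k : Type*} [Fintype σ] [LinearOrder σ] [Field k] (x : σ → k)
    (hx : ∀ i, x i ≠ 0) :
    (((torusElt x hx)⁻¹ : GL σ k) : Matrix σ σ k) = Matrix.diagonal fun i => (x i)⁻¹ := by
  have h : (torusElt x hx : GL σ k) * torusElt (fun i => (x i)⁻¹) (fun i => inv_ne_zero (hx i)) = 1 := by
    ext1
    rw [Units.val_mul, coe_torusElt, coe_torusElt, Matrix.diagonal_mul_diagonal, Units.val_one,
      ← Matrix.diagonal_one]
    congr 1
    funext i
    exact mul_inv_cancel₀ (hx i)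
  rw [inv_eq_of_mul_eq_one_right h, coe_torusElt]

/-- **Homogeneity as a substitution identity**: `G(c·x) = c^n G(x)` for `G ∈ Hom_n`. [folklore] -/
theorem aeval_smul_X_of_mem_homogeneousSubmodule {σ : Type*} [Fintype σ] [DecidableEq σ]
    {G : MvPolynomial σ ℂ} {n : ℕ} (hG : G ∈ MvPolynomial.homogeneousSubmodule σ ℂ n) (c : ℂ) :
    MvPolynomial.aeval (fun p : σ => c • (X p : MvPolynomial σ ℂ)) G = c ^ n • G := by
  classical
  have hlin : (MvPolynomial.aeval fun p : σ => c • (X p : MvPolynomial σ ℂ)) =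
      linSubst σ ℂ (Matrix.diagonal fun _ => c) := by
    apply MvPolynomial.algHom_ext
    intro p
    rw [aeval_X, linSubst_X, Finset.sum_eq_single p (fun j _ hj => by
      rw [Matrix.diagonal_apply_ne _ hj, zero_smul]) (fun h => absurd (Finset.mem_univ p) h),
      Matrix.diagonal_apply_eq]
  rw [hlin]
  conv_lhs => rw [G.as_sum]
  rw [map_sum]
  conv_rhs => rw [G.as_sum]
  rw [Finset.smul_sum]
  refine Finset.sum_congr rfl fun e he => ?_
  rw [linSubst_diagonal_monomial]
  congr 1
  have hdeg : e.degree = n := by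
    rw [Finsupp.degree_eq_weight_one]
    exact (mem_homogeneousSubmodule n G).mp hG (mem_support_iff.mp he)
  rw [Finsupp.prod, Finset.prod_pow_eq_pow_sum, ← hdeg, Finsupp.degree_apply]

/-- **The scalar clause.** For a `B`-semi-invariant `G` of weight `χ` with `∑ χ = -s`, the scalar
`c⁻¹·1 ∈ B` gives `G(c·x) = c^s G(x)`. [folklore] -/
theorem aeval_smul_X_of_mem_borelSemiInvariants {χ : Weight (MatIdx m)}
    {G : MvPolynomial (MatIdx m × MatIdx m) ℂ} (hB : G ∈ borelSemiInvariants m χ) {s : ℕ}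
    (hs : χ.size = -(s : ℤ)) {c : ℂ} (hc : c ≠ 0) :
    MvPolynomial.aeval (fun p : MatIdx m × MatIdx m => c • (X p : MvPolynomial _ ℂ)) G = c ^ s • G := by
  classical
  set g : GL (MatIdx m) ℂ := torusElt (fun _ : MatIdx m => c⁻¹) (fun _ => inv_ne_zero hc) with hg
  have hgU : IsUpperTriangular g := (isDiagonalGL_torusElt _ _).isUpperTriangular
  have h := (mem_borelSemiInvariants_iff.mp hB) g hgU
  have hfun : (fun p : MatIdx m × MatIdx m => ∑ l : MatIdx m,
      ((g⁻¹ : GL (MatIdx m) ℂ) : Matrix (MatIdx m) (MatIdx m) ℂ) p.1 l • (X (l, p.2) : MvPolynomial _ ℂ)) =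
      fun p => c • X p := by
    funext p
    rw [hg, coe_inv_torusElt, Finset.sum_eq_single p.1 (fun l _ hl => by
      rw [Matrix.diagonal_apply_ne _ (Ne.symm hl), zero_smul]) (fun h => absurd (Finset.mem_univ _) h),
      Matrix.diagonal_apply_eq, inv_inv]
  have hw : weightChar χ g = c ^ s := by
    rw [hg, weightChar_torusElt, prod_zpow_eq_zpow_sum (inv_ne_zero hc)]
    change c⁻¹ ^ χ.size = c ^ s
    rw [hs, zpow_neg, inv_zpow, inv_inv, zpow_natCast]
  rw [hfun, hw] at h
  exact h

/-- Distinct powers of `2` are distinct in `ℂ`. [folklore] -/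
theorem two_pow_ne_two_pow {n s : ℕ} (h : n ≠ s) : (2 : ℂ) ^ n ≠ (2 : ℂ) ^ s := by
  intro h2
  apply h
  apply Nat.pow_right_injective (le_refl 2)
  exact_mod_cast h2

/-- **DEGREE–SIZE MISMATCH KILLS `T`.** A form of degree `n` that is a `B`-semi-invariant of a
weight of size `-s ≠ -n` is zero (compare the two scalar identities at `c = 2`). This is the Lean
form of "a weight pins the degree" read backwards, and it is what makes the guard
`λ.parts.card ≤ m*m` load-bearing (a truncated weight has the wrong size). [folklore] -/
theorem eq_zero_of_degree_ne_size {χ : Weight (MatIdx m)} {G : MvPolynomial (MatIdx m × MatIdx m) ℂ}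
    {n s : ℕ} (hG : G ∈ MvPolynomial.homogeneousSubmodule (MatIdx m × MatIdx m) ℂ n)
    (hB : G ∈ borelSemiInvariants m χ) (hs : χ.size = -(s : ℤ)) (hns : n ≠ s) : G = 0 := by
  have h1 := aeval_smul_X_of_mem_homogeneousSubmodule hG (2 : ℂ)
  have h2 := aeval_smul_X_of_mem_borelSemiInvariants hB hs (two_ne_zero)
  rw [h1] at h2
  have h3 : ((2 : ℂ) ^ n - 2 ^ s) • G = 0 := by rw [sub_smul, h2, sub_self]
  rcases smul_eq_zero.mp h3 with h4 | h4
  · exact absurd (sub_eq_zero.mp h4) (two_pow_ne_two_pow hns)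
  · exact h4

/-- With a degree/size mismatch the whole truncation vanishes, whatever `L`, `t`. [folklore] -/
theorem truncation_eq_bot_of_degree_ne_size (L : Set (MatIdx m × MatIdx m → ℂ)) (t : ℕ)
    {n s : ℕ} {χ : Weight (MatIdx m)} (hs : χ.size = -(s : ℤ)) (hns : n ≠ s) :
    truncation m L t n χ = ⊥ := by
  rw [eq_bot_iff]
  intro G hG
  rw [mem_truncation_iff] at hG
  exact (Submodule.mem_bot ℂ).mpr (eq_zero_of_degree_ne_size hG.1 hG.2.2.2 hs hns)

end Scalar

section CardGuard

/-- The partition `(1,1) ⊢ 2 = 1·2`: two parts, more than `m*m = 1` slots at `m = 1`. [folklore] -/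
def lamOneOne : Nat.Partition (1 * 2) :=
  Nat.Partition.ofSums (1 * 2) {1, 1} (by norm_num)

/-- The parts of `(1,1)`. [folklore] -/
theorem lamOneOne_parts : lamOneOne.parts = {1, 1} := by
  simp [lamOneOne, Nat.Partition.ofSums]

/-- `(1,1)` has two parts. [folklore] -/
theorem card_parts_lamOneOne : lamOneOne.parts.card = 2 := by
  rw [lamOneOne_parts]; rfl

/-- Every sorted part of `(1,1)` is `1`. [folklore] -/
theorem eq_one_of_mem_sortedParts_lamOneOne {a : ℕ} (ha : a ∈ lamOneOne.sortedParts) : a = 1 := by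
  rw [Nat.Partition.sortedParts, Multiset.mem_sort, lamOneOne_parts] at ha
  simpa using ha

/-- The largest part of `(1,1)` is `1`. [folklore] -/
theorem getD_sortedParts_lamOneOne_zero : lamOneOne.sortedParts.getD 0 0 = 1 := by
  have hlen : 0 < lamOneOne.sortedParts.length := by
    rw [Nat.Partition.length_sortedParts, card_parts_lamOneOne]; norm_num
  rw [List.getD_eq_getElem _ _ hlen]
  exact eq_one_of_mem_sortedParts_lamOneOne (List.getElem_mem hlen)

/-- At `m = 1` every matrix index is the last one. [folklore] -/
theorem eq_iLast_one (i : MatIdx 1) : i = iLast 1 := by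
  rw [← toLex_ofLex i, iLast]
  congr 1
  exact Prod.ext (Subsingleton.elim _ _) (Subsingleton.elim _ _)

/-- The TRUNCATED dual weight of `(1,1)` on `GL_1` is `(-1)`: the second part is silently dropped
(the documented junk of `Weight.ofPartition`), so the weight has size `-1` although `|λ| = 2`. [folklore] -/
theorem toMatIdx_dualOfPartition_lamOneOne :
    (Weight.dualOfPartition (1 * 1) lamOneOne).toMatIdx = lastWeight 1 (1 * 1) := by
  funext i
  obtain rfl := eq_iLast_one i
  simp only [Weight.toMatIdx, lastWeight, if_true]
  have hidx : (matIdxEquiv 1).symm (iLast 1) = ⟨1 * 1 - 1, by norm_num⟩ :=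
    Fin.ext (val_matIdxEquiv_symm_iLast 1)
  rw [hidx, Weight.dualOfPartition_apply_last lamOneOne (by norm_num : 0 < 1 * 1),
    getD_sortedParts_lamOneOne_zero]

/-- **Any proof must use the guard `λ.parts.card ≤ m*m`.** Witness `m = 1`, `U = 0`, `r = 0`,
`δ = 2`, `λ = (1,1)`: the truncated weight is `(-1)` (size `-1`), `K_1((-1)) = 1` (class of the
coordinate `X`), but `T ⊆ Hom_2 ∩ {B-semi-invariants of size -1} = 0` by the degree–size
mismatch (`eq_zero_of_degree_ne_size`). So `1 ≤ 0`. (Same witness as the tree's docstring of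
`orbitMultiplicity_det_le_kroneckerCoeff`, l.575–580, and as gen-1's
`valuativeBound_false_without_card`.) [folklore] -/
theorem valuativeBound_false_without_card :
    ¬ (∀ (m : ℕ) [NeZero m] (U : Submodule ℂ (MatIdx m → ℂ)) (r : ℕ),
        (∀ u ∈ U, (Matrix.of fun a b : Fin m => u (toLex (a, b))).rank ≤ r) →
        ∀ (δ : ℕ) (lam : Nat.Partition (m * δ)),
          orbitMultiplicity ℂ (detFormLex ℂ m) m (Weight.dualOfPartition (m * m) lam).toMatIdx ≤
            Module.finrank ℂ (truncation m (rowLocus m U) (δ * (m - r)) (m * δ)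
              (Weight.dualOfPartition (m * m) lam).toMatIdx)) := by
  intro h
  have h1 := h 1 ⊥ 0 (fun u hu => by
    rw [(Submodule.mem_bot ℂ).mp hu]
    have h0 : (Matrix.of fun a b : Fin 1 => (0 : MatIdx 1 → ℂ) (toLex (a, b))) = 0 := rfl
    rw [h0, Matrix.rank_zero]) 2 lamOneOne
  rw [toMatIdx_dualOfPartition_lamOneOne,
    truncation_eq_bot_of_degree_ne_size (m := 1) (rowLocus 1 ⊥) (2 * (1 - 0)) (n := 1 * 2) (s := 1 * 1)
      (by simp [Weight.size, lastWeight]) (by norm_num),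
    finrank_bot] at h1
  exact Nat.not_succ_le_zero _ (le_trans (one_le_orbitMultiplicity_det_lastWeight 1 1) h1)

end CardGuard

end Summit.ValiantsHypothesis.Theorems.ValuativeBoundNegative

end
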